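import Mathlib

/-!
# T5PadicRigidity — `ℚ_p` is rigid: every ring endomorphism of `ℚ_[p]` is the identity

Tier-5 support (seat p7, cell pub-hodge-repro2) for route/T5-CHECK-G-p7.md §12.2 row P1.5 and
T5-LEAN-p7.md §22 (b)(iii): the printed hypothesis speaks of «the p-adic places induced by
elements in Σ via ι_p».  At a prime of degree one the completion is `ℚ_p` (the chain
T5DegreeOne*), and the identification of an embedding `F → ℚ_p` with the place it induces rests
on the classical fact that `ℚ_p` has no non-trivial endomorphisms.  This file proves that fact
from Mathlib alone:

* the units of `ℤ_p` inside `ℚ_p` are characterised ALGEBRAICALLY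
  (`norm_eq_one_iff_forall_exists_pow`): for `u ≠ 0`, `‖u‖ = 1` iff `u ^ (2 (p - 1))` has an
  `n`-th root for every `n` coprime to `p` (Hensel's lemma for the direct implication, a
  valuation count for the converse);
* hence every ring homomorphism `f : ℚ_[p] →+* ℚ_[p]` preserves the norm (`norm_map`), is an
  isometry, is continuous, and — being the identity on the dense subfield `ℚ` — is the identity
  (`ringHom_eq_id`); `Subsingleton (ℚ_[p] →+* ℚ_[p])`, every ring automorphism is `refl`, and
  every ring endomorphism of `ℤ_[p]` is the identity as well.

Nothing about number fields, CM types or Hecke characters is asserted here.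
-/

open Polynomial

namespace Summit.Ventures.HodgeRepro2.T5PadicRigidity

variable {p : ℕ} [hp : Fact p.Prime]

/-- Hensel's lemma for `n`-th roots in `ℤ_[p]`: if `n` is coprime to `p` and `‖b - 1‖ < 1`, then
`b` is an `n`-th power in `ℤ_[p]`. -/
theorem exists_pow_eq_of_norm_sub_one_lt (n : ℕ) (hn : n.Coprime p) (b : ℤ_[p])
    (hb : ‖b - 1‖ < 1) : ∃ z : ℤ_[p], z ^ n = b := by
  have hn0 : n ≠ 0 := by
    rintro rfl
    exact hp.out.one_lt.ne' (Nat.coprime_zero_left p |>.mp hn)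
  set F : Polynomial ℤ_[p] := X ^ n - C b with hF
  have h1 : aeval (1 : ℤ_[p]) F = 1 - b := by simp [hF]
  have h2 : aeval (1 : ℤ_[p]) (derivative F) = (n : ℤ_[p]) := by
    simp [hF, derivative_X_pow]
  have hnorm : ‖aeval (1 : ℤ_[p]) F‖ < ‖aeval (1 : ℤ_[p]) (derivative F)‖ ^ 2 := by
    rw [h1, h2, PadicInt.norm_natCast_eq_one_iff.mpr hn.symm, one_pow, ← norm_neg, neg_sub]
    exact hb
  obtain ⟨z, hz, -⟩ := hensels_lemma hnorm
  refine ⟨z, ?_⟩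
  have : aeval z F = z ^ n - b := by simp [hF]
  rw [this] at hz
  exact sub_eq_zero.mp hz

/-- Fermat's little theorem in `ℤ_[p]`: for a unit `u`, `‖u ^ (p - 1) - 1‖ < 1`. -/
theorem norm_pow_sub_one_lt_of_isUnit {u : ℤ_[p]} (hu : IsUnit u) : ‖u ^ (p - 1) - 1‖ < 1 := by
  have hu0 : PadicInt.toZMod u ≠ 0 := by
    intro h
    have hmem : u ∈ IsLocalRing.maximalIdeal ℤ_[p] := by
      rw [← PadicInt.ker_toZMod]; exact h
    rw [IsLocalRing.mem_maximalIdeal, PadicInt.mem_nonunits] at hmem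
    exact hmem.ne (PadicInt.isUnit_iff.mp hu)
  have hpow : PadicInt.toZMod (u ^ (p - 1) - 1) = 0 := by
    rw [map_sub, map_pow, map_one, ZMod.pow_card_sub_one_eq_one hu0, sub_self]
  have hmem : u ^ (p - 1) - 1 ∈ IsLocalRing.maximalIdeal ℤ_[p] := by
    rw [← PadicInt.ker_toZMod]; exact hpow
  rw [IsLocalRing.mem_maximalIdeal, PadicInt.mem_nonunits] at hmem
  exact hmem

/-- For a unit `u` of `ℤ_[p]`, `‖u ^ (2 (p - 1)) - 1‖ < 1` (the square of Fermat). -/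
theorem norm_pow_two_mul_sub_one_lt_of_isUnit {u : ℤ_[p]} (hu : IsUnit u) :
    ‖u ^ (2 * (p - 1)) - 1‖ < 1 := by
  have h := norm_pow_sub_one_lt_of_isUnit hu
  have hfac : u ^ (2 * (p - 1)) - 1 = (u ^ (p - 1) - 1) * (u ^ (p - 1) + 1) := by
    rw [mul_comm 2, pow_mul]; ring
  rw [hfac, norm_mul]
  calc ‖u ^ (p - 1) - 1‖ * ‖u ^ (p - 1) + 1‖ ≤ ‖u ^ (p - 1) - 1‖ * 1 :=
        mul_le_mul_of_nonneg_left (PadicInt.norm_le_one _) (norm_nonneg _)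
    _ = ‖u ^ (p - 1) - 1‖ := mul_one _
    _ < 1 := h

/-- The norm-one elements of `ℚ_[p]` are characterised algebraically: for `u ≠ 0`,
`‖u‖ = 1` iff `u ^ (2 (p - 1))` is an `n`-th power for every `n` coprime to `p`. -/
theorem norm_eq_one_iff_forall_exists_pow {u : ℚ_[p]} (hu : u ≠ 0) :
    ‖u‖ = 1 ↔ ∀ n : ℕ, n.Coprime p → ∃ y : ℚ_[p], y ^ n = u ^ (2 * (p - 1)) := by
  constructor
  · intro h n hn
    set v : ℤ_[p] := ⟨u, h.le⟩ with hv
    have hvu : IsUnit v := PadicInt.isUnit_iff.mpr (by rw [PadicInt.norm_def]; exact h)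
    obtain ⟨z, hz⟩ := exists_pow_eq_of_norm_sub_one_lt n hn (v ^ (2 * (p - 1)))
      (norm_pow_two_mul_sub_one_lt_of_isUnit hvu)
    refine ⟨(z : ℚ_[p]), ?_⟩
    have := congrArg (fun w : ℤ_[p] => (w : ℚ_[p])) hz
    simpa [PadicInt.coe_pow, hv] using this
  · intro h
    by_contra hne
    -- the valuation of `u` is a non-zero integer `k`
    have hval : u.valuation ≠ 0 := by
      intro h0
      apply hne
      rw [Padic.norm_eq_zpow_neg_valuation hu, h0, neg_zero, zpow_zero]
    set m : ℤ := (2 * (p - 1) : ℕ) * u.valuation with hm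
    have hm0 : m ≠ 0 := by
      refine mul_ne_zero ?_ hval
      have : (2 * (p - 1) : ℕ) ≠ 0 := by
        have := hp.out.two_le
        omega
      exact_mod_cast this
    -- a prime `q ≠ p` with `q > |m|`
    obtain ⟨q, hq, hqprime⟩ := Nat.exists_infinite_primes (p + m.natAbs + 1)
    have hqp : q ≠ p := by omega
    have hcop : q.Coprime p := (Nat.coprime_primes hqprime hp.out).mpr hqp
    obtain ⟨y, hy⟩ := h q hcop
    have hy0 : y ≠ 0 := by
      rintro rfl
      have : (0 : ℚ_[p]) ^ q = 0 := zero_pow hqprime.ne_zero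
      rw [this] at hy
      exact hu (pow_eq_zero_iff (by have := hp.out.two_le; omega) |>.mp hy.symm)
    have hvy := congrArg Padic.valuation hy
    rw [Padic.valuation_pow, Padic.valuation_pow] at hvy
    -- `q ∣ m` with `0 < |m| < q`: impossible
    have hdvd : (q : ℤ) ∣ m := ⟨y.valuation, by rw [hm, ← hvy]⟩
    have hle : m.natAbs ≥ q := Nat.le_of_dvd (Int.natAbs_pos.mpr hm0)
      (by simpa using Int.natAbs_dvd_natAbs.mpr hdvd)
    omega

/-- A ring homomorphism `ℚ_[p] →+* ℚ_[p]` sends norm-one elements to norm-one elements. -/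
theorem norm_map_eq_one (f : ℚ_[p] →+* ℚ_[p]) {u : ℚ_[p]} (hu : ‖u‖ = 1) : ‖f u‖ = 1 := by
  have hu0 : u ≠ 0 := by rintro rfl; simp at hu
  have hfu : f u ≠ 0 := (map_ne_zero f).mpr hu0
  rw [norm_eq_one_iff_forall_exists_pow hfu]
  intro n hn
  obtain ⟨y, hy⟩ := (norm_eq_one_iff_forall_exists_pow hu0).mp hu n hn
  exact ⟨f y, by rw [← map_pow, hy, map_pow]⟩

/-- A ring homomorphism `ℚ_[p] →+* ℚ_[p]` preserves the `p`-adic norm. -/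
theorem norm_map (f : ℚ_[p] →+* ℚ_[p]) (x : ℚ_[p]) : ‖f x‖ = ‖x‖ := by
  rcases eq_or_ne x 0 with rfl | hx
  · simp
  set k : ℤ := x.valuation with hk
  set u : ℚ_[p] := x * (p : ℚ_[p]) ^ (-k) with hu
  have hp0 : (p : ℚ_[p]) ≠ 0 := by exact_mod_cast hp.out.ne_zero
  have hpR : (0 : ℝ) < p := by exact_mod_cast hp.out.pos
  have hunorm : ‖u‖ = 1 := by
    rw [hu, norm_mul, Padic.norm_p_zpow, Padic.norm_eq_zpow_neg_valuation hx, ← hk,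
      neg_neg, ← zpow_add₀ hpR.ne', neg_add_cancel, zpow_zero]
  have hxu : x = u * (p : ℚ_[p]) ^ k := by
    rw [hu, mul_assoc, ← zpow_add₀ hp0, neg_add_cancel, zpow_zero, mul_one]
  have hfp : f (p : ℚ_[p]) = p := map_natCast f p
  rw [hxu, map_mul, map_zpow₀, hfp, norm_mul, norm_mul, norm_map_eq_one f hunorm, hunorm]

/-- A ring homomorphism `ℚ_[p] →+* ℚ_[p]` is an isometry. -/
theorem isometry (f : ℚ_[p] →+* ℚ_[p]) : Isometry f :=
  AddMonoidHomClass.isometry_of_norm f (norm_map f)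

/-- A ring homomorphism `ℚ_[p] →+* ℚ_[p]` is continuous. -/
theorem continuous (f : ℚ_[p] →+* ℚ_[p]) : Continuous f :=
  (isometry f).continuous

/-- **Rigidity of `ℚ_p`**: every ring homomorphism `ℚ_[p] →+* ℚ_[p]` is the identity. -/
theorem ringHom_eq_id (f : ℚ_[p] →+* ℚ_[p]) : f = RingHom.id ℚ_[p] := by
  have h : ⇑f = id :=
    (Padic.denseRange_ratCast p).equalizer (continuous f) continuous_id
      (funext fun q => by simp [map_ratCast])
  ext x
  exact congrFun h x

/-- Pointwise form of `ringHom_eq_id`: `f x = x` for every ring homomorphism `f : ℚ_[p] →+* ℚ_[p]`. -/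
theorem ringHom_apply (f : ℚ_[p] →+* ℚ_[p]) (x : ℚ_[p]) : f x = x := by
  rw [ringHom_eq_id f]; rfl

/-- `ℚ_[p]` has exactly one ring endomorphism. -/
theorem subsingleton_ringHom : Subsingleton (ℚ_[p] →+* ℚ_[p]) :=
  ⟨fun f g => by rw [ringHom_eq_id f, ringHom_eq_id g]⟩

/-- Every ring automorphism of `ℚ_[p]` is the identity. -/
theorem ringEquiv_eq_refl (e : ℚ_[p] ≃+* ℚ_[p]) : e = RingEquiv.refl ℚ_[p] := by
  ext x
  exact ringHom_apply e.toRingHom x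

/-- `ℚ_[p]` has exactly one ring automorphism. -/
theorem subsingleton_ringEquiv : Subsingleton (ℚ_[p] ≃+* ℚ_[p]) :=
  ⟨fun e e' => by rw [ringEquiv_eq_refl e, ringEquiv_eq_refl e']⟩

/-- Two ring homomorphisms into `ℚ_[p]` that differ by an endomorphism of `ℚ_[p]` are equal. -/
theorem eq_of_comp_eq {R : Type*} [Semiring R] (f : ℚ_[p] →+* ℚ_[p]) (g : R →+* ℚ_[p]) :
    f.comp g = g := by
  rw [ringHom_eq_id f, RingHom.id_comp]

/-- A ring homomorphism `ℤ_[p] →+* ℤ_[p]` is injective (its kernel is an ideal of `ℤ_[p]`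
not containing any power of `p`). -/
theorem padicInt_ringHom_injective (g : ℤ_[p] →+* ℤ_[p]) : Function.Injective g := by
  rw [RingHom.injective_iff_ker_eq_bot]
  by_contra hne
  obtain ⟨n, hn⟩ := PadicInt.ideal_eq_span_pow_p hne
  have hmem : (p : ℤ_[p]) ^ n ∈ RingHom.ker g := by
    rw [hn]; exact Ideal.mem_span_singleton_self _
  rw [RingHom.mem_ker, map_pow, map_natCast] at hmem
  exact pow_ne_zero n (by exact_mod_cast hp.out.ne_zero) hmem

/-- Every ring endomorphism of `ℤ_[p]` is the identity (it extends to `ℚ_[p]`, where it is the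
identity by `ringHom_eq_id`). -/
theorem padicInt_ringHom_eq_id (g : ℤ_[p] →+* ℤ_[p]) : g = RingHom.id ℤ_[p] := by
  have hinj : Function.Injective ((algebraMap ℤ_[p] ℚ_[p]).comp g) :=
    (IsFractionRing.injective ℤ_[p] ℚ_[p]).comp (padicInt_ringHom_injective g)
  set F : ℚ_[p] →+* ℚ_[p] := IsFractionRing.lift (A := ℤ_[p]) (K := ℚ_[p]) hinj with hF
  have hFg : ∀ x : ℤ_[p], F (algebraMap ℤ_[p] ℚ_[p] x) = algebraMap ℤ_[p] ℚ_[p] (g x) := fun x =>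
    IsFractionRing.lift_algebraMap hinj x
  ext x
  have := hFg x
  rw [ringHom_apply F] at this
  exact (IsFractionRing.injective ℤ_[p] ℚ_[p] this).symm

end Summit.Ventures.HodgeRepro2.T5PadicRigidity
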